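import Literature.NumberTheory.EllipticCurves.IwasawaSelmerControlKernelCardProofs
import HarnessLib

/-!
# Crux `PrintCf2.SplitBadTwoRankOneOfFacts` (stmt-BirchSwinnertonDyer-20368), road α v10.3 — S3c residual (R-SURJ), file 2/3:
# THE INFLATION KERNEL — `#ker (res : H¹(K, M) → H¹(K_∞, M)) = #(M(K_∞) ⧸ (γ − 1) M(K_∞))` EXACTLY, for any discrete `p`-primary `M`

Cell `bsd-print-cf2`, width seat `bsd-line-cf2-p1-w5` g3 (prover-bsd-line-cf2-p1-w5-g3-0); lane «(R-SURJ)» of LEAD g12's residual board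
(`LEAD-VERDICT-cf2p1-g12.md` §6; cut 4 = `restrictedControl_two_of_residuals_split_places`, p666063). `--supports stmt-BirchSwinnertonDyer-20368`
(helper, Theses-free). HONEST FRAMING: nothing here closes the crux or a registered stub; BSD is not proved by any of this; no summit statement
is proved by this seat. No definition, no named fact, no `sorry`.

WHAT. The kernel of `res : H¹(K, M) → H¹(K_∞, M)` along a `ℤ_p`-line `κ` (top `K_∞ = K̄^{ker κ}`, generator `γ`) is `H¹(Γ, M(K_∞)) ≅
M(K_∞)/(γ − 1)M(K_∞)` (inflation–restriction + `H¹` of a procyclic group). The tree has this as an ISOMORPHISM for `M = E[p^∞]`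
(`WeierstrassCurve.kerLayerToInftyEquiv`, `IwasawaSelmerControlKernelCardProofs`) and as a BOUND for generic `M` in the `H = ⊤` currency of the
restricted-Selmer control files (`natCard_ker_resOfLe_le_top_le`, p654573). THIS FILE gives the EQUALITY for generic `M` (any number field `K`,
any `p`, any discrete `p`-primary `Γ_K`-module `M` with continuous orbit maps):
* `ker_resOfLe_layer_eq_subgroupResKer` — `ker (res : H¹(H_n, M) → H¹(ker κ, M))` is the tree's `ResKernel.subgroupResKer` for
  `(ker κ).subgroupOf H_n` (port of `WeierstrassCurve.ker_layerToInfty_eq_subgroupResKer`);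
* `natCard_ker_resOfLe_layer_eq` — `#ker (res : H¹(K_n, M) → H¹(K_∞, M)) = #(M(K_∞) ⧸ (γ^{pⁿ} − 1) M(K_∞))` (`ResKernel.kerResEquivQuot`:
  generation `ZpExtension.layerSubgroup_eq_top_of_isOpen`, inflation cocycles `ZpExtension.exists_cocycle_vanishing_apply_eq`);
* **`natCard_ker_resOfLe_top_eq` — `#ker (res : H¹(⊤, M) → H¹(ker κ, M)) = #(M(K_∞) ⧸ (γ − 1) M(K_∞))`** (`n = 0` transported along
  `H¹(⊤, M) ≅ H¹(κ⁻¹(p⁰ℤ_p), M)`, `ZpExtension.layerSubgroup_zero`, `resOfLe_comp`/`resOfLe_refl`).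
Used by file 3/3 (`…RestrictedSelmerCokernelExactOfFrame`): on every road-α frame `#(W*(K*_∞)/(γ'−1)) = 2` (p656507), so `#ker(res) = 2`.
presearch: Greenberg LNM 1716 §3 Lemma 3.1 (held, PDF p. 86: "By the inflation-restriction sequence, `ker(h_n) ≅ H¹(Γ_n, B)` … `= B/(γ^{pⁿ} − 1)B`");
Serre *Galois Cohomology* I §2.6, XIII §1 — held; no new Literature fact filed. beyond-print theorem: no.

References: [GreenbergLNM1716] §3 Lemma 3.1 (p. 86), §4 Lemma 4.3 (p. 103); [SerreGaloisCohomology1997] I §2.6, XIII §1.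
-/

noncomputable section

open scoped Classical

set_option linter.dupNamespace false
set_option autoImplicit false

open NumberField IsDedekindDomain Field
open Literature.NumberTheory.EllipticCurves
open Literature.NumberTheory.EllipticCurves.ResKernel
open Literature.NumberTheory.GaloisRepresentations

universe u

namespace Summit.BirchSwinnertonDyer.BirchSwinnertonDyer.Theorems.PrintCf2.RestrictedSelmerPair

/-! ## §3. The inflation kernel: `#ker (res : H¹(K, M) → H¹(K_∞, M)) = #(M(K_∞) ⧸ (γ − 1) M(K_∞))` EXACTLY (generic `M`) -/

section KerRes

variable {K : Type u} [Field K] [NumberField K] {p : ℕ} [Fact p.Prime] (κ : ZpExtension K p)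
  (M : Type u) [AddCommGroup M] [DistribMulAction (absoluteGaloisGroup K) M]
  [TopologicalSpace M] [DiscreteTopology M]

omit [NumberField K] in
/-- **`ker (res : H¹(K_n, M) → H¹(K_∞, M)) = ker (res : H¹(H_n, M) → H¹((ker κ) ∩ H_n, M))`** as subgroups of `H¹(H_n, M)`,
`H_n = κ⁻¹(pⁿℤ_p)` — the tree's `ResKernel.subgroupResKer` for the subgroup `(ker κ).subgroupOf H_n` of the topological group `H_n`
(generic-`M` form of `WeierstrassCurve.ker_layerToInfty_eq_subgroupResKer`: both maps are induced by the same compatible pair up to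
`(ker κ).subgroupOf H_n ≃ ker κ`; a class restricting to zero is represented by a cocycle vanishing on `Gal(K̄/K_∞)`).
[cite: GreenbergLNM1716, §3 Lemma 3.1 (p. 86)] -/
theorem ker_resOfLe_layer_eq_subgroupResKer (hcont : ∀ m : M, Continuous fun g : absoluteGaloisGroup K ↦ g • m) (n : ℕ) :
    (resOfLe M (κ.kerSubgroup_le_layerSubgroup n)).ker =
      subgroupResKer M (κ.kerSubgroup.subgroupOf (κ.layerSubgroup n)) := by
  let Hn : Subgroup (absoluteGaloisGroup K) := κ.layerSubgroup n
  let N : Subgroup Hn := κ.kerSubgroup.subgroupOf Hn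
  have hcont' : ∀ m : M, Continuous fun g : Hn ↦ g • m := fun m ↦ (hcont m).comp continuous_subtype_val
  apply le_antisymm
  · intro c hc
    let j : N →ₜ* κ.kerSubgroup :=
      { toFun := fun x ↦ ⟨((x : Hn) : absoluteGaloisGroup K), Subgroup.mem_subgroupOf.mp x.2⟩
        map_one' := rfl
        map_mul' := fun _ _ ↦ rfl
        continuous_toFun := (continuous_subtype_val.comp continuous_subtype_val).subtype_mk _ }
    have hcomp : (resH1Hom j (AddMonoidHom.id M) (fun _ _ ↦ rfl)).comp (resOfLe M (κ.kerSubgroup_le_layerSubgroup n)) =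
        resSubgroup N M := by
      unfold Literature.NumberTheory.EllipticCurves.resOfLe ResKernel.resSubgroup
      rw [resH1Hom_comp]
      exact resH1Hom_congr (ContinuousMonoidHom.ext fun _ ↦ rfl) (AddMonoidHom.ext fun _ ↦ rfl) _ _
    rw [mem_subgroupResKer_iff, ← hcomp, AddMonoidHom.comp_apply, (AddMonoidHom.mem_ker).mp hc, map_zero]
  · intro x hx
    obtain ⟨φ, hφ, hφN⟩ := exists_cocycle_of_res_eq_zero N M hcont' x hx
    rw [AddMonoidHom.mem_ker, ← hφ]
    have hres : resOfLe M (κ.kerSubgroup_le_layerSubgroup n) (oneCocycleClass _ φ) =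
        oneCocycleClass _ (contOneCocycles.pullback
          (subgroupInclusion (κ.kerSubgroup_le_layerSubgroup n))
          (resHomOfEquivariant (subgroupInclusion (κ.kerSubgroup_le_layerSubgroup n))
            (AddMonoidHom.id M) (fun _ _ ↦ rfl)) φ) :=
      map_oneCocycleClass _ _ _ φ
    have h0 : contOneCocycles.pullback (subgroupInclusion (κ.kerSubgroup_le_layerSubgroup n))
        (resHomOfEquivariant (subgroupInclusion (κ.kerSubgroup_le_layerSubgroup n))
          (AddMonoidHom.id M) (fun _ _ ↦ rfl)) φ = 0 := by
      apply Subtype.ext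
      refine ContinuousMap.ext fun τ ↦ ?_
      rw [contOneCocycles.pullback_apply]
      exact hφN ⟨(τ : absoluteGaloisGroup K), κ.kerSubgroup_le_layerSubgroup n τ.2⟩ (Subgroup.mem_subgroupOf.mpr τ.2)
    rw [hres, h0, oneCocycleClass_zero]

/-- **`#ker (res : H¹(K_n, M) → H¹(K_∞, M)) = #(M(K_∞) ⧸ (γ^{pⁿ} − 1) M(K_∞))`** (`Nat.card`, finite or not) for ANY discrete `p`-primary
`Γ_K`-module `M` with continuous orbit maps, `κ γ = 1` (generic-`M` form of `WeierstrassCurve.natCard_ker_layerToInfty_eq`: the tree's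
`ResKernel.kerResEquivQuot` — evaluation at `γ^{pⁿ}` of a representative vanishing on `Gal(K̄/K_∞)`, injective by generation
(`ZpExtension.layerSubgroup_eq_top_of_isOpen`), onto by the inflation cocycles `ZpExtension.exists_cocycle_vanishing_apply_eq`).
[cite: GreenbergLNM1716, §3 Lemma 3.1 (p. 86: "ker(h_n) ≅ H¹(Γ_n, B) = B/(γ^{pⁿ} − 1)B")] -/
theorem natCard_ker_resOfLe_layer_eq {γ : absoluteGaloisGroup K} (hγ : κ.IsTopGenerator γ)
    (hcont : ∀ m : M, Continuous fun g : absoluteGaloisGroup K ↦ g • m) (hprim : ∀ m : M, ∃ k : ℕ, p ^ k • m = 0) (n : ℕ) :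
    Nat.card (resOfLe M (κ.kerSubgroup_le_layerSubgroup n)).ker =
      Nat.card (FixedPoints.addSubgroup κ.kerSubgroup M ⧸ (subOne κ.kerSubgroup M (γ ^ p ^ n)).range) := by
  let Hn : Subgroup (absoluteGaloisGroup K) := κ.layerSubgroup n
  let N : Subgroup Hn := κ.kerSubgroup.subgroupOf Hn
  let γn : Hn := ⟨γ ^ p ^ n, κ.pow_mem_layerSubgroup hγ n⟩
  have hgen : ∀ U : Subgroup Hn, IsOpen (U : Set Hn) → N ≤ U → γn ∈ U → U = ⊤ :=
    fun U hU hNU hγU ↦ κ.layerSubgroup_eq_top_of_isOpen hγ n U hU hNU hγU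
  have hcont' : ∀ m : M, Continuous fun g : Hn ↦ g • m := fun m ↦ (hcont m).comp continuous_subtype_val
  have hinf : ∀ b : FixedPoints.addSubgroup N M, ∃ ψ : contOneCocycles (discreteTopRep Hn M),
      (∀ x ∈ N, ψ.1 x = 0) ∧ ψ.1 γn = b := by
    intro b
    have hb : ∀ τ ∈ κ.kerSubgroup, τ • (b : M) = b := fun τ hτ ↦
      b.2 ⟨⟨τ, κ.kerSubgroup_le_layerSubgroup n hτ⟩, Subgroup.mem_subgroupOf.mpr hτ⟩
    obtain ⟨ψ, hψN, hψγ⟩ := κ.exists_cocycle_vanishing_apply_eq hγ n hcont hprim b hb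
    exact ⟨ψ, fun x hx ↦ hψN x (Subgroup.mem_subgroupOf.mp hx), hψγ⟩
  -- `M^N = M^{ker κ}`, compatibly with `γ^{pⁿ} − 1`
  have hfix : FixedPoints.addSubgroup N M = FixedPoints.addSubgroup κ.kerSubgroup M := by
    ext m
    simp only [FixedPoints.mem_addSubgroup]
    constructor
    · intro h τ
      exact h ⟨⟨τ, κ.kerSubgroup_le_layerSubgroup n τ.2⟩, Subgroup.mem_subgroupOf.mpr τ.2⟩
    · intro h x
      exact h ⟨((x : Hn) : absoluteGaloisGroup K), Subgroup.mem_subgroupOf.mp x.2⟩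
  let e : FixedPoints.addSubgroup N M ≃+ FixedPoints.addSubgroup κ.kerSubgroup M := AddEquiv.addSubgroupCongr hfix
  have he : AddSubgroup.map (e : FixedPoints.addSubgroup N M →+ FixedPoints.addSubgroup κ.kerSubgroup M)
      (subOne N M γn).range = (subOne κ.kerSubgroup M (γ ^ p ^ n)).range := by
    ext b
    constructor
    · rintro ⟨x, ⟨y, rfl⟩, rfl⟩
      exact ⟨e y, Subtype.ext rfl⟩
    · rintro ⟨y, rfl⟩
      exact ⟨subOne N M γn (e.symm y), ⟨e.symm y, rfl⟩, Subtype.ext rfl⟩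
  exact Nat.card_congr (((AddEquiv.addSubgroupCongr (ker_resOfLe_layer_eq_subgroupResKer κ M hcont n)).trans
    (ResKernel.kerResEquivQuot N M γn hgen hcont' hinf)).trans (QuotientAddGroup.congr _ _ e he)).toEquiv

/-- **`#ker (res : H¹(K, M) → H¹(K_∞, M)) = #(M(K_∞) ⧸ (γ − 1) M(K_∞))` = `#H¹(Γ, M(K_∞))`** (`Nat.card`), the case `n = 0` transported
along the restriction isomorphism `H¹(⊤, M) ≅ H¹(κ⁻¹(p⁰ℤ_p), M)` (`ZpExtension.layerSubgroup_zero`; `resOfLe_comp`, `resOfLe_refl`). This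
upgrades the tree's BOUND `natCard_ker_resOfLe_le_top_le` (p654573) to an EQUALITY: the inflation kernel of Greenberg's Lemma 3.1 in the
`H = ⊤` currency of the control files. [cite: GreenbergLNM1716, §3 Lemma 3.1 (p. 86)] -/
theorem natCard_ker_resOfLe_top_eq {γ : absoluteGaloisGroup K} (hγ : κ.IsTopGenerator γ)
    (hcont : ∀ m : M, Continuous fun g : absoluteGaloisGroup K ↦ g • m) (hprim : ∀ m : M, ∃ k : ℕ, p ^ k • m = 0) :
    Nat.card (resOfLe M (le_top : κ.kerSubgroup ≤ ⊤)).ker =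
      Nat.card (FixedPoints.addSubgroup κ.kerSubgroup M ⧸ (subOne κ.kerSubgroup M γ).range) := by
  have h0 := natCard_ker_resOfLe_layer_eq κ M hγ hcont hprim 0
  simp only [pow_zero, pow_one] at h0
  rw [← h0]
  -- the bijection `ker res_⊤ ≃ ker res_{H_0}` by restriction along `H_0 ≤ ⊤` / `⊤ ≤ H_0`
  have hl : Function.LeftInverse (resOfLe M (le_of_eq (ZpExtension.layerSubgroup_zero κ).symm))
      (resOfLe M (le_top : κ.layerSubgroup 0 ≤ ⊤)) := fun c ↦ by
    rw [← AddMonoidHom.comp_apply, resOfLe_comp_holds, resOfLe_refl_holds, AddMonoidHom.id_apply]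
  have hr : Function.RightInverse (resOfLe M (le_of_eq (ZpExtension.layerSubgroup_zero κ).symm))
      (resOfLe M (le_top : κ.layerSubgroup 0 ≤ ⊤)) := fun c ↦ by
    rw [← AddMonoidHom.comp_apply, resOfLe_comp_holds, resOfLe_refl_holds, AddMonoidHom.id_apply]
  refine Nat.card_congr
    { toFun := fun c ↦ ⟨resOfLe M (le_top : κ.layerSubgroup 0 ≤ ⊤) c.1, by
        rw [AddMonoidHom.mem_ker, ← AddMonoidHom.comp_apply, resOfLe_comp_holds]
        exact c.2⟩
      invFun := fun d ↦ ⟨resOfLe M (le_of_eq (ZpExtension.layerSubgroup_zero κ).symm) d.1, by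
        rw [AddMonoidHom.mem_ker, ← AddMonoidHom.comp_apply, resOfLe_comp_holds]
        exact (AddMonoidHom.mem_ker).mp d.2⟩
      left_inv := fun c ↦ Subtype.ext (hl c.1)
      right_inv := fun d ↦ Subtype.ext (hr d.1) }

end KerRes
end Summit.BirchSwinnertonDyer.BirchSwinnertonDyer.Theorems.PrintCf2.RestrictedSelmerPair

end
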